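import Summits.QuantumFields.YangMills.Theorems.BalabanUVNodesK0V23Stub3ComparabilitySuppliers
import Summits.QuantumFields.YangMills.Theses.BalabanUVNodes

/-!
# CRIT-1 g31 ADD4 §5 (post-seam addendum) — located-B of idea-1..4 on the K0 side, AFTER campaign «O» row 1: with the SEAM `Node00/Record13CoP.lean`
# ✓p775188 in the tree (`UbgOfRecord₁₃CoP_succ` :180, `rfl`), V23's displayed `hseam` is `rfl`, and §4′ `k0Body_of_seam_of_twoComparableZB` of
# `Theorems/BalabanUVNodesK0V23Stub3ComparabilitySuppliers.lean` ✓p772656 gives K0⁷'s DECL (stmt-QuantumFields-20541, VERBATIM) from the COMPARABILITY CORE ALONE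

Cell `ym-nodeO-ideate`, seat `ym-nodeO-crit-1` (CRITIC idea-1..4), refuter-ym-nodeO-crit-1-g31-0, 2026-08-30 ≈14:15Z.  Crux workfile on stmt-QuantumFields-20543
(companion of `CRIT-1-ADD4-idea1-g31-anchor-bound-located-B.md` rev 2 §5 and of `Crit1Add4AnchorBoundSketch.lean`).  BY-NAME COMPOSITION ONLY (two `rfl`s and one
application); CRIT-1 files NOTHING on the gate and writes no evidence on 20541 — the post-seam discharge is the K0 seats' ∕ campaign «O»'s filing; this file only
CERTIFIES the located-B statement the desk prices against: «post-seam, the K0 consumer's whole residual need is NODE O's weakest K0 letter, the comparability core».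

HONEST FRAMING: CONDITIONAL on the comparability core `comp` (a HYPOTHESIS — NODE O's wall read along runs; inhabited nowhere); nothing of Bałaban asserted or
discharged; K0⁷ 20541 NOT closed (V23 not registered; the core not delivered); K1⁹ ∕ K2⁷ ∕ K3⁸ OPEN; counts UNMOVED; R4 = the CONDITIONAL finite-𝕋⁴ rung
`BalabanLadder.UV` only; the Yang–Mills mass gap (Clay) is NOT proved by any of this.
-/

open scoped Matrix.Norms.L2Operator

namespace Summit.QuantumFields.YangMills.Cruxes.EndpointGivenBR13SepCoPH.Crit1Add4PostSeamK0

open Literature.MathematicalPhysics.QuantumFieldTheory.Balaban1983to89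
open Literature.MathematicalPhysics.QuantumFieldTheory.Balaban1983to89.Node00
open Literature.MathematicalPhysics.QuantumFieldTheory.Balaban1983to89.T4Continuum
open Literature.MathematicalPhysics.QuantumFieldTheory.Balaban1983to89.FlowStep
open Literature.MathematicalPhysics.QuantumFieldTheory.Balaban1983to89.B15DeterminingSets
open Summit.QuantumFields.YangMills.Theorems.K0V23Stub3ComparabilitySuppliers

/-- **THE COMPARABILITY CORE** (V23's `(comp :` binder of `k0Body_of_seam_of_twoComparableZB`, VERBATIM; local name for readability only). HYPOTHESIS SHAPE —
NODE O's weakest K0-side letter. [cite: Balaban1987RG1, Thm 3 p.264, §1 p.264; Balaban1988Convergent, (2.6)–(2.8) pp.255–256] -/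
def ComparabilityCore : Prop :=
  ∀ (F : T4Family) (a₀ : ℝ), 0 < a₀ → ∃ γ₀ ε₂₉ : ℝ, 0 < γ₀ ∧ 0 < ε₂₉ ∧ ∀ (j : ℕ) (ε₀ B₃ B₃' a₁ : ℝ),
    ∀ (n : ℕ) (gs : ℕ → ℝ), RGEqH n (betaOfRecord₁₃ F 2 (theta13OfThm1CCMWZB F 2 j (1 / 2) a₀ ε₀ ε₂₉ B₃ B₃' a₀ a₁ (fun _ _ => 0) (fun _ _ => 0))) gs → Step.InInterval γ₀ n gs →
      ∀ m, m < n → gs m ≤ 2 * gs (m + 1) ∧ gs (m + 1) ≤ 2 * gs m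

/-- **POST-SEAM, V23's displayed `hseam` IS `rfl`** (the landed seam `Node00.UbgOfRecord₁₃CoP_succ`, ✓p775188). [cite: Balaban1988Convergent, (2.12)–(2.13) pp.256–257] -/
theorem hseam_rfl :
    ∀ (F : T4Family) (θ : Stage13Params F 2) (p : B12.RunParams) (n : ℕ) (s : SeqOfRecord F θ.ν θ.τ9.M (gOfRecord₁₃ F 2 θ p) p.K (n + 1)) (W : MSField (F.P p.K) (SU 2)),
      UbgOfRecord₁₃CoP F 2 θ p (n + 1) s W = UbgMSCoPOfRecordB F 2 θ.ν θ.τ9.M (gOfRecord₁₃ F 2 θ p) p.K (n + 1) s W :=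
  fun _ _ _ _ _ _ => rfl

/-- **★ POST-SEAM: K0⁷'s DECL (stmt-QuantumFields-20541 `Record13SepCoPHInhabited`, VERBATIM) FROM THE COMPARABILITY CORE ALONE, BY NAME** (§4′ of ✓p772656 with
`hseam := rfl`).  CONDITIONAL on the core; K0⁷ NOT closed. [cite: Balaban1985Variational, Thm 1 (8)–(9) p.279; Balaban1988Convergent, Thm 1 p.262, (2.6)–(2.8) pp.255–256] -/
theorem record13SepCoPHInhabited_of_comparabilityCore_postSeam (comp : ComparabilityCore) :
    Summit.QuantumFields.YangMills.Theses.BalabanUVNodes.Record13SepCoPHInhabited :=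
  k0Body_of_seam_of_twoComparableZB hseam_rfl comp

end Summit.QuantumFields.YangMills.Cruxes.EndpointGivenBR13SepCoPH.Crit1Add4PostSeamK0
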